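/-
Copyright (c) 2026 the pub-hodgecm-mathlib formalisation cell (harness21).  Prover seat hodgecm-mathlib-K2E3-p03 (g9): Track B «K2-LIT»,
#184♮ = hLiu418 = stmt-HodgeConjecture-24832; K1b ∕ ρ desk K2Liu-p14 (g4) DESK WORD #5 (4), LEAD F0P6-plan (g14) BATCH #165 (3): brick (ρ7) —
ONE open finite-adelic level fixing ALL parameters of a continuous standard section family.  THEOREMS ONLY (no `def`, no `instance`, no `notation`,
no named-fact hypothesis, no `sorry`).
-/
import Summits.HodgeConjecture.HodgeConjecture.Theorems.K2LiuIwasawaDatumStdSmooth   -- ★ Lemma K-f `exists_isOpen_forall_mul_eq_of_isStd` (one parameter)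
import HarnessLib

/-!
# Crux `HLiu418`, K1b ∕ (ρ7) — `K2LiuStandardFamilyUniformLevel`: A UNIFORM OPEN LEVEL FOR A STANDARD SECTION FAMILY

Cell `hodgecm-mathlib`, crux item hLiu418 = `stmt-HodgeConjecture-24832`; squad K2 ∕ K2Liu (L1, LEAD F0P6-plan (g14)), road `K2_Liu`, kind-one line (K1b), brick (ρ7)
of K2Liu-p14 (g4)'s DESK WORD #5; consumer = (P-supp) `Theorems/K2LiuKindOneLineSupportIntrinsic.lean` (binder BY VALUE `(Kf : Subgroup HA, hKf : ∀ s x k, k ∈ Kf →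
f s (x * k) = f s x)`) and the bridge to (P-supp-lat) `K2LiuKindOneLineLatticeLetters` (letters `archPart b = 1 → finPart (h⁻¹ b h) ∈ U → …`).  Lane
`--supports stmt-HodgeConjecture-24832 --as helper` (count-neutral helper; closes no socket by itself).  General frame `e : Fin N × Fin M ≃ Fin n`.

THE MATHEMATICS [Tan1999, §1 p. 166], [HarrisKudlaSweet1996, §1 (1.15)–(1.17)], [BorelJacquet1979, §4.1].  Let `𝒦` be a STANDARD Iwasawa datum of the doubled
unitary group `H(𝔸)` (★ `IwasawaDatum.IsStd`: `𝒦.K = C_∞·C_f` with `C_f` open in `H(𝔸_f)`) and `f = (f_s)_s` a STANDARD family of Siegel sections (★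
`IsStandardSectionFamily 𝒦 χ f`: section law `f_s(p·y) = δ_s^χ(p)·f_s(y)` on `P_Δ(𝔸)`, `K`-finiteness of every `f_s`, flatness `f_s|_K = f_{s₀}|_K`).
* §1 **TRANSPORT** `forall_mul_eq_of_forall_mem_mul_eq_at` — if `k ∈ 𝒦.K` fixes `f_{s₀}` on `K` from the right (`f_{s₀}(κk) = f_{s₀}(κ)` for `κ ∈ K`) then `k` fixes
  EVERY `f_s` EVERYWHERE: with the Iwasawa decomposition `x = p·κ` (a FIELD of `IwasawaDatum`), `f_s(xk) = f_s(p·(κk)) = δ_s^χ(p)·f_{s₀}(κk) = δ_s^χ(p)·f_{s₀}(κ) =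
  f_s(x)` (★ `IsStandardSectionFamily.apply_delta_mul` twice).  `𝒦.IsStd` and continuity are NOT needed here.
* §2 **ONE LEVEL FOR ALL `s`** `exists_uniformLevel_of_isStandardSectionFamily_at` — for `𝒦` standard and `f_{s₀}` continuous at ONE parameter `s₀` there is an OPEN
  subgroup `U ≤ H(𝔸_f)` inside the finite part `C_f` of `𝒦.K` (so `(1,u) ∈ 𝒦.K` for `u ∈ U`, ★ `IsStd.exists_fin`) such that every `k = (1,u)`, `u ∈ U` (★ `archPart k = 1`,
  ★ `finPart k ∈ U`) fixes every `f_s`: ★ Lemma K-f `exists_isOpen_forall_mul_eq_of_isStd h𝒦 (hstd.2.1 s₀) hcont` gives a level `U₀` for `f_{s₀}`; take `U := U₀ ⊓ C_f` and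
  transport by §1.  The desk's head BYTES `exists_uniformLevel_of_isStandardSectionFamily (h𝒦) (hstd) (hcont : ∀ s, Continuous (f s))` are the one-line corollary at `s₀ = 0`.
* §3 **THE LEVEL SUBGROUP `Kf ≤ H(𝔸)`** `exists_levelSubgroup_of_isStandardSectionFamily(_at)` — the same packaged as (P-supp) consumes it: a subgroup `Kf ≤ 𝒦.K` of `H(𝔸)`
  with `k ∈ Kf ↔ archPart k = 1 ∧ finPart k ∈ U` (`Kf = finPart⁻¹(U) ⊓ ker archPart`, built inside the proof — no `def`) and `∀ s x k, k ∈ Kf → f s (x * k) = f s x`;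
  plus the bridge `conj_mem_of_archPart_eq_one` (`archPart b = 1`, `finPart (h⁻¹ b h) ∈ U` ⟹ `h⁻¹ b h ∈ Kf`) that turns (P-supp-lat)'s letters into `Kf`-membership.
[cite: Tan1999, §1 p. 166] [cite: HarrisKudlaSweet1996, §1 (1.15)–(1.17)] [cite: BorelJacquet1979, §4.1]

HONEST LABEL.  Count-neutral helper; it retires nothing by itself: `HC_CM` is proved only modulo the 7 printed citations (2 remaining named inputs:
hLiu418 = `stmt-HodgeConjecture-24832`, h413 = `stmt-HodgeConjecture-24833`) until rung 0 closes.

## References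
* [Tan1999] V. Tan, *Poles of Siegel Eisenstein series on U(n,n)*, Canad. J. Math. 51 (1999), §1 p. 166 (standard sections, `K`-finite and right-`K_f`-smooth).
* [HarrisKudlaSweet1996] M. Harris, S. Kudla, W. J. Sweet, *Theta dichotomy for unitary groups*, J. AMS 9 (1996), §1 (1.15)–(1.17).
* [BorelJacquet1979] A. Borel, H. Jacquet, *Automorphic forms and automorphic representations*, Proc. Symp. Pure Math. 33.1 (1979), §4.1 (`G(𝔸) = G_∞ × G(𝔸_f)`,
  smooth vectors at the finite places).
-/

set_option autoImplicit false
set_option linter.dupNamespace false -- the mandated namespace repeats `HodgeConjecture.HodgeConjecture`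

noncomputable section

open NumberField
open Literature.NumberTheory.Automorphic Literature.NumberTheory.GaloisRepresentations
open Literature.NumberTheory.GelbartRogawski1991 Literature.NumberTheory.GelbartRogawski1991.GRConstruction
open Literature.NumberTheory.K2Lit.SiegelDoubled
open Summit.HodgeConjecture.HodgeConjecture.Cruxes.HLiu418.K2LiuIwasawaDatumStdSmooth

namespace Summit.HodgeConjecture.HodgeConjecture.Cruxes.HLiu418.K2LiuStandardFamilyUniformLevel

variable {L : Type} [Field L] [NumberField L] [IsCMField L]
variable {N M n : ℕ} {e : Fin N × Fin M ≃ Fin n}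
  {dV : Fin N → L} {hdV : ∀ i, IsCMField.complexConj L (dV i) = dV i}
  {dW : Fin M → L} {hdW : ∀ i, IsCMField.complexConj L (dW i) = dW i}
variable {𝒦 : IwasawaDatum L e dV hdV dW hdW} {χ : HeckeCharacter L} {f : ℂ → HA L e dV hdV dW hdW → ℂ}

/-! ## §1 Transport of right-invariance from `K` at one parameter to `H(𝔸)` at all parameters -/

/-- **TRANSPORT.**  For a standard family `f` and `k ∈ 𝒦.K`: if right translation by `k` fixes `f_{s₀}` on `K` (`f_{s₀}(κ·k) = f_{s₀}(κ)` for all `κ ∈ 𝒦.K`) at ONE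
parameter `s₀`, then it fixes `f_s` on all of `H(𝔸)` at EVERY parameter `s`: `x = p·κ` (Iwasawa), `f_s(x·k) = δ_s^χ(p)·f_{s₀}(κ·k) = δ_s^χ(p)·f_{s₀}(κ) = f_s(x)`
(★ `IsStandardSectionFamily.apply_delta_mul`).  Neither `𝒦.IsStd` nor continuity is used. [cite: Tan1999, §1 p. 166] [cite: HarrisKudlaSweet1996, §1 (1.17)] -/
theorem forall_mul_eq_of_forall_mem_mul_eq_at (hstd : IsStandardSectionFamily 𝒦 χ f) (s₀ : ℂ) {k : HA L e dV hdV dW hdW} (hk : k ∈ 𝒦.K)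
    (hfix : ∀ κ : HA L e dV hdV dW hdW, κ ∈ 𝒦.K → f s₀ (κ * k) = f s₀ κ) (s : ℂ) (x : HA L e dV hdV dW hdW) :
    f s (x * k) = f s x := by
  obtain ⟨p, κ, hp, hκ, rfl⟩ := 𝒦.iwasawa x
  rw [mul_assoc, hstd.apply_delta_mul s s₀ hp (𝒦.K.mul_mem hκ hk), hfix κ hκ, ← hstd.apply_delta_mul s s₀ hp hκ]

/-- **TRANSPORT, global hypothesis.**  Same with the invariance of `f_{s₀}` given on all of `H(𝔸)` (the shape ★ Lemma K-f delivers). [cite: Tan1999, §1 p. 166] -/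
theorem forall_mul_eq_of_forall_mul_eq_at (hstd : IsStandardSectionFamily 𝒦 χ f) (s₀ : ℂ) {k : HA L e dV hdV dW hdW} (hk : k ∈ 𝒦.K)
    (hfix : ∀ y : HA L e dV hdV dW hdW, f s₀ (y * k) = f s₀ y) (s : ℂ) (x : HA L e dV hdV dW hdW) :
    f s (x * k) = f s x :=
  forall_mul_eq_of_forall_mem_mul_eq_at hstd s₀ hk (fun κ _ => hfix κ) s x

/-- **`(1, k_f) ∈ 𝒦.K` when `k_f ∈ C_f`.**  An element of `H(𝔸)` with trivial archimedean component whose finite component lies in a subgroup `U` mapped into `𝒦.K`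
by `u ↦ (1,u)` lies in `𝒦.K` (`k = (k_∞,1)·(1,k_f)`, ★ `archToAdelic_mul_finAdelicToAdelic`). [cite: BorelJacquet1979, §4.1] -/
theorem mem_K_of_archPart_eq_one
    {U : Subgroup (UnitaryGroup.finAdelic (Fp L) L (IsCMField.complexConj L) (n + n) (hermD L e dV hdV dW hdW))}
    (hUK : ∀ u ∈ U, (UnitaryGroup.finAdelicToAdelic (Fp L) L (IsCMField.complexConj L) (n + n) (hermD L e dV hdV dW hdW) u :
      HA L e dV hdV dW hdW) ∈ 𝒦.K)
    {k : HA L e dV hdV dW hdW} (hk1 : UnitaryGroup.archPart (Fp L) L (IsCMField.complexConj L) (n + n) (hermD L e dV hdV dW hdW) k = 1)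
    (hkU : UnitaryGroup.finPart (Fp L) L (IsCMField.complexConj L) (n + n) (hermD L e dV hdV dW hdW) k ∈ U) : k ∈ 𝒦.K := by
  have h1 := UnitaryGroup.archToAdelic_mul_finAdelicToAdelic (Fp L) L (IsCMField.complexConj L) (n + n) (hermD L e dV hdV dW hdW) k
  rw [hk1, map_one, one_mul] at h1
  rw [← h1]
  exact hUK _ hkU

/-! ## §2 One open level for all parameters -/

/-- **ONE OPEN LEVEL FOR ALL `s` (strong form, at one parameter).**  For a STANDARD Iwasawa datum `𝒦` and a standard family `f` with `f_{s₀}` continuous, there is an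
OPEN subgroup `U ≤ H(𝔸_f)` with `(1,u) ∈ 𝒦.K` for `u ∈ U` such that every `k ∈ H(𝔸)` with `archPart k = 1` and `finPart k ∈ U` fixes EVERY `f_s` from the right:
`f_s(x·k) = f_s(x)` for all `s`, `x`.  (★ Lemma K-f at `s₀`, intersected with the finite part `C_f` of `𝒦.K`, transported by §1.)
[cite: Tan1999, §1 p. 166] [cite: HarrisKudlaSweet1996, §1 (1.16)–(1.17)] [cite: BorelJacquet1979, §4.1] -/
theorem exists_uniformLevel_of_isStandardSectionFamily_at (h𝒦 : 𝒦.IsStd) (hstd : IsStandardSectionFamily 𝒦 χ f) (s₀ : ℂ)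
    (hcont : Continuous (f s₀)) :
    ∃ U : Subgroup (UnitaryGroup.finAdelic (Fp L) L (IsCMField.complexConj L) (n + n) (hermD L e dV hdV dW hdW)),
      IsOpen (U : Set (UnitaryGroup.finAdelic (Fp L) L (IsCMField.complexConj L) (n + n) (hermD L e dV hdV dW hdW))) ∧
      (∀ u ∈ U, (UnitaryGroup.finAdelicToAdelic (Fp L) L (IsCMField.complexConj L) (n + n) (hermD L e dV hdV dW hdW) u :
        HA L e dV hdV dW hdW) ∈ 𝒦.K) ∧
      ∀ k : HA L e dV hdV dW hdW,
        UnitaryGroup.archPart (Fp L) L (IsCMField.complexConj L) (n + n) (hermD L e dV hdV dW hdW) k = 1 →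
        UnitaryGroup.finPart (Fp L) L (IsCMField.complexConj L) (n + n) (hermD L e dV hdV dW hdW) k ∈ U →
        ∀ (s : ℂ) (x : HA L e dV hdV dW hdW), f s (x * k) = f s x := by
  -- ★ Lemma K-f: a level `U₀` for the single continuous `K`-finite function `f s₀`
  obtain ⟨U₀, hU₀o, hU₀⟩ := exists_isOpen_forall_mul_eq_of_isStd h𝒦 (hstd.2.1 s₀) hcont
  -- the finite part `C_f` of the standard datum
  obtain ⟨Cfin, hCo, hCK, -⟩ := h𝒦.exists_fin
  refine ⟨U₀ ⊓ Cfin, ?_, fun u hu => hCK u (Subgroup.mem_inf.1 hu).2, fun k hk1 hkU => ?_⟩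
  · rw [Subgroup.coe_inf]
    exact hU₀o.inter hCo
  · obtain ⟨hkU₀, hkC⟩ := Subgroup.mem_inf.1 hkU
    exact forall_mul_eq_of_forall_mul_eq_at hstd s₀ (mem_K_of_archPart_eq_one hCK hk1 hkC) (hU₀ k hk1 hkU₀)

/-- **ONE OPEN LEVEL FOR ALL `s`** — the desk's head (K2Liu-p14 (g4) DESK WORD #5 (4)): for `𝒦` standard and a standard family `f` of continuous sections there is an
OPEN subgroup `U ≤ H(𝔸_f)` such that `f_s(x·k) = f_s(x)` for all `s`, `x` and all `k` with `archPart k = 1`, `finPart k ∈ U`.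
[cite: Tan1999, §1 p. 166] [cite: HarrisKudlaSweet1996, §1 (1.16)–(1.17)] [cite: BorelJacquet1979, §4.1] -/
theorem exists_uniformLevel_of_isStandardSectionFamily (h𝒦 : 𝒦.IsStd) (hstd : IsStandardSectionFamily 𝒦 χ f) (hcont : ∀ s, Continuous (f s)) :
    ∃ U : Subgroup (UnitaryGroup.finAdelic (Fp L) L (IsCMField.complexConj L) (n + n) (hermD L e dV hdV dW hdW)),
      IsOpen (U : Set (UnitaryGroup.finAdelic (Fp L) L (IsCMField.complexConj L) (n + n) (hermD L e dV hdV dW hdW))) ∧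
      ∀ k : HA L e dV hdV dW hdW,
        UnitaryGroup.archPart (Fp L) L (IsCMField.complexConj L) (n + n) (hermD L e dV hdV dW hdW) k = 1 →
        UnitaryGroup.finPart (Fp L) L (IsCMField.complexConj L) (n + n) (hermD L e dV hdV dW hdW) k ∈ U →
        ∀ (s : ℂ) (x : HA L e dV hdV dW hdW), f s (x * k) = f s x := by
  obtain ⟨U, hUo, -, hU⟩ := exists_uniformLevel_of_isStandardSectionFamily_at h𝒦 hstd 0 (hcont 0)
  exact ⟨U, hUo, hU⟩

/-- **Variant — the level also lies in `𝒦.K`**: same head, recording in addition that every such `k` lies in `𝒦.K`. [cite: Tan1999, §1 p. 166] [cite: BorelJacquet1979, §4.1] -/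
theorem exists_uniformLevel_mem_K_of_isStandardSectionFamily (h𝒦 : 𝒦.IsStd) (hstd : IsStandardSectionFamily 𝒦 χ f) (hcont : ∀ s, Continuous (f s)) :
    ∃ U : Subgroup (UnitaryGroup.finAdelic (Fp L) L (IsCMField.complexConj L) (n + n) (hermD L e dV hdV dW hdW)),
      IsOpen (U : Set (UnitaryGroup.finAdelic (Fp L) L (IsCMField.complexConj L) (n + n) (hermD L e dV hdV dW hdW))) ∧
      ∀ k : HA L e dV hdV dW hdW,
        UnitaryGroup.archPart (Fp L) L (IsCMField.complexConj L) (n + n) (hermD L e dV hdV dW hdW) k = 1 →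
        UnitaryGroup.finPart (Fp L) L (IsCMField.complexConj L) (n + n) (hermD L e dV hdV dW hdW) k ∈ U →
        k ∈ 𝒦.K ∧ ∀ (s : ℂ) (x : HA L e dV hdV dW hdW), f s (x * k) = f s x := by
  obtain ⟨U, hUo, hUK, hU⟩ := exists_uniformLevel_of_isStandardSectionFamily_at h𝒦 hstd 0 (hcont 0)
  exact ⟨U, hUo, fun k hk1 hkU => ⟨mem_K_of_archPart_eq_one hUK hk1 hkU, hU k hk1 hkU⟩⟩

/-! ## §3 The level subgroup `Kf ≤ H(𝔸)` ((P-supp)'s binder) -/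

/-- **BRIDGE — conjugates with trivial archimedean part.**  If `Kf ≤ H(𝔸)` is cut out by `archPart k = 1 ∧ finPart k ∈ U`, then for `b` with `archPart b = 1` and any `h`,
`finPart (h⁻¹·b·h) ∈ U` implies `h⁻¹·b·h ∈ Kf` (`archPart` is a homomorphism: `archPart (h⁻¹ b h) = (archPart h)⁻¹·1·archPart h = 1`).  This turns the letters of
(P-supp-lat) into the `Kf`-membership premise of (P-supp). [cite: BorelJacquet1979, §4.1] -/
theorem conj_mem_of_archPart_eq_one
    {U : Subgroup (UnitaryGroup.finAdelic (Fp L) L (IsCMField.complexConj L) (n + n) (hermD L e dV hdV dW hdW))} {Kf : Subgroup (HA L e dV hdV dW hdW)}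
    (hKf : ∀ k : HA L e dV hdV dW hdW, k ∈ Kf ↔
      UnitaryGroup.archPart (Fp L) L (IsCMField.complexConj L) (n + n) (hermD L e dV hdV dW hdW) k = 1 ∧
        UnitaryGroup.finPart (Fp L) L (IsCMField.complexConj L) (n + n) (hermD L e dV hdV dW hdW) k ∈ U)
    {b : HA L e dV hdV dW hdW} (hb : UnitaryGroup.archPart (Fp L) L (IsCMField.complexConj L) (n + n) (hermD L e dV hdV dW hdW) b = 1)
    (h : HA L e dV hdV dW hdW)
    (hfin : UnitaryGroup.finPart (Fp L) L (IsCMField.complexConj L) (n + n) (hermD L e dV hdV dW hdW) (h⁻¹ * b * h) ∈ U) :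
    h⁻¹ * b * h ∈ Kf := by
  -- `archPart` read on `H(𝔸)`-typed products (`HA` carries the subgroup instances, `archPart` the datum's: equal up to unfolding)
  have hmul : ∀ x y : HA L e dV hdV dW hdW,
      UnitaryGroup.archPart (Fp L) L (IsCMField.complexConj L) (n + n) (hermD L e dV hdV dW hdW) (x * y : HA L e dV hdV dW hdW) =
      UnitaryGroup.archPart (Fp L) L (IsCMField.complexConj L) (n + n) (hermD L e dV hdV dW hdW) x *
        UnitaryGroup.archPart (Fp L) L (IsCMField.complexConj L) (n + n) (hermD L e dV hdV dW hdW) y := fun x y => map_mul _ x y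
  have hinv : ∀ x : HA L e dV hdV dW hdW,
      UnitaryGroup.archPart (Fp L) L (IsCMField.complexConj L) (n + n) (hermD L e dV hdV dW hdW) (x⁻¹ : HA L e dV hdV dW hdW) =
      (UnitaryGroup.archPart (Fp L) L (IsCMField.complexConj L) (n + n) (hermD L e dV hdV dW hdW) x)⁻¹ := fun x => map_inv _ x
  exact (hKf _).2 ⟨by rw [hmul, hmul, hinv, hb, mul_one, inv_mul_cancel], hfin⟩

/-- **`Kf` contains every `(1,u)`, `u ∈ U`** (★ `archPart_finAdelicToAdelic`, ★ `finPart_finAdelicToAdelic`). [cite: BorelJacquet1979, §4.1] -/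
theorem finAdelicToAdelic_mem_of_mem
    {U : Subgroup (UnitaryGroup.finAdelic (Fp L) L (IsCMField.complexConj L) (n + n) (hermD L e dV hdV dW hdW))} {Kf : Subgroup (HA L e dV hdV dW hdW)}
    (hKf : ∀ k : HA L e dV hdV dW hdW, k ∈ Kf ↔
      UnitaryGroup.archPart (Fp L) L (IsCMField.complexConj L) (n + n) (hermD L e dV hdV dW hdW) k = 1 ∧
        UnitaryGroup.finPart (Fp L) L (IsCMField.complexConj L) (n + n) (hermD L e dV hdV dW hdW) k ∈ U)
    {u : UnitaryGroup.finAdelic (Fp L) L (IsCMField.complexConj L) (n + n) (hermD L e dV hdV dW hdW)} (hu : u ∈ U) :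
    (UnitaryGroup.finAdelicToAdelic (Fp L) L (IsCMField.complexConj L) (n + n) (hermD L e dV hdV dW hdW) u : HA L e dV hdV dW hdW) ∈ Kf :=
  (hKf _).2 ⟨UnitaryGroup.archPart_finAdelicToAdelic (Fp L) L (IsCMField.complexConj L) (n + n) (hermD L e dV hdV dW hdW) u,
    by rw [UnitaryGroup.finPart_finAdelicToAdelic]; exact hu⟩

/-- **THE LEVEL SUBGROUP (strong form, at one parameter).**  For `𝒦` standard and a standard family `f` with `f_{s₀}` continuous there are an OPEN subgroup
`U ≤ H(𝔸_f)` and a subgroup `Kf ≤ H(𝔸)` — `Kf = {k | archPart k = 1 ∧ finPart k ∈ U} = finPart⁻¹(U) ⊓ ker archPart` — with `Kf ≤ 𝒦.K` and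
`f_s(x·k) = f_s(x)` for all `s`, `x` and `k ∈ Kf`: the binder `(Kf, hKf)` of (P-supp) `K2LiuKindOneLineSupportIntrinsic`.
[cite: Tan1999, §1 p. 166] [cite: HarrisKudlaSweet1996, §1 (1.16)–(1.17)] [cite: BorelJacquet1979, §4.1] -/
theorem exists_levelSubgroup_of_isStandardSectionFamily_at (h𝒦 : 𝒦.IsStd) (hstd : IsStandardSectionFamily 𝒦 χ f) (s₀ : ℂ)
    (hcont : Continuous (f s₀)) :
    ∃ (U : Subgroup (UnitaryGroup.finAdelic (Fp L) L (IsCMField.complexConj L) (n + n) (hermD L e dV hdV dW hdW)))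
      (Kf : Subgroup (HA L e dV hdV dW hdW)),
      IsOpen (U : Set (UnitaryGroup.finAdelic (Fp L) L (IsCMField.complexConj L) (n + n) (hermD L e dV hdV dW hdW))) ∧
      (∀ k : HA L e dV hdV dW hdW, k ∈ Kf ↔
        UnitaryGroup.archPart (Fp L) L (IsCMField.complexConj L) (n + n) (hermD L e dV hdV dW hdW) k = 1 ∧
          UnitaryGroup.finPart (Fp L) L (IsCMField.complexConj L) (n + n) (hermD L e dV hdV dW hdW) k ∈ U) ∧
      (∀ k : HA L e dV hdV dW hdW, k ∈ Kf → k ∈ 𝒦.K) ∧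
      ∀ (s : ℂ) (x k : HA L e dV hdV dW hdW), k ∈ Kf → f s (x * k) = f s x := by
  obtain ⟨U, hUo, hUK, hU⟩ := exists_uniformLevel_of_isStandardSectionFamily_at h𝒦 hstd s₀ hcont
  refine ⟨U, U.comap (UnitaryGroup.finPart (Fp L) L (IsCMField.complexConj L) (n + n) (hermD L e dV hdV dW hdW)) ⊓
      (UnitaryGroup.archPart (Fp L) L (IsCMField.complexConj L) (n + n) (hermD L e dV hdV dW hdW)).ker, hUo, fun k => ?_, fun k hk => ?_,
    fun s x k hk => ?_⟩
  · -- membership in `comap` ∕ `ker` ∕ `⊓` is definitionally the displayed conjunction (`Subgroup.mem_comap`, `MonoidHom.mem_ker`, `Subgroup.mem_inf` are `Iff.rfl`)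
    exact ⟨fun hk => ⟨(Subgroup.mem_inf.1 hk).2, (Subgroup.mem_inf.1 hk).1⟩, fun hk => Subgroup.mem_inf.2 ⟨hk.2, hk.1⟩⟩
  · exact mem_K_of_archPart_eq_one hUK (Subgroup.mem_inf.1 hk).2 (Subgroup.mem_inf.1 hk).1
  · exact hU k (Subgroup.mem_inf.1 hk).2 (Subgroup.mem_inf.1 hk).1 s x

/-- **THE LEVEL SUBGROUP** — all parameters continuous (the desk's hypotheses): an OPEN `U ≤ H(𝔸_f)` and `Kf = {k | archPart k = 1 ∧ finPart k ∈ U} ≤ 𝒦.K` with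
`∀ s x k, k ∈ Kf → f s (x * k) = f s x`. [cite: Tan1999, §1 p. 166] [cite: HarrisKudlaSweet1996, §1 (1.16)–(1.17)] [cite: BorelJacquet1979, §4.1] -/
theorem exists_levelSubgroup_of_isStandardSectionFamily (h𝒦 : 𝒦.IsStd) (hstd : IsStandardSectionFamily 𝒦 χ f) (hcont : ∀ s, Continuous (f s)) :
    ∃ (U : Subgroup (UnitaryGroup.finAdelic (Fp L) L (IsCMField.complexConj L) (n + n) (hermD L e dV hdV dW hdW)))
      (Kf : Subgroup (HA L e dV hdV dW hdW)),
      IsOpen (U : Set (UnitaryGroup.finAdelic (Fp L) L (IsCMField.complexConj L) (n + n) (hermD L e dV hdV dW hdW))) ∧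
      (∀ k : HA L e dV hdV dW hdW, k ∈ Kf ↔
        UnitaryGroup.archPart (Fp L) L (IsCMField.complexConj L) (n + n) (hermD L e dV hdV dW hdW) k = 1 ∧
          UnitaryGroup.finPart (Fp L) L (IsCMField.complexConj L) (n + n) (hermD L e dV hdV dW hdW) k ∈ U) ∧
      (∀ k : HA L e dV hdV dW hdW, k ∈ Kf → k ∈ 𝒦.K) ∧
      ∀ (s : ℂ) (x k : HA L e dV hdV dW hdW), k ∈ Kf → f s (x * k) = f s x :=
  exists_levelSubgroup_of_isStandardSectionFamily_at h𝒦 hstd 0 (hcont 0)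

end Summit.HodgeConjecture.HodgeConjecture.Cruxes.HLiu418.K2LiuStandardFamilyUniformLevel

end
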